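import Literature.AnabelianGeometry.EtaleTheta.EtaleThetaDataOfClass
import Literature.AnabelianGeometry.EtaleTheta.ThetaCyclotomes
import Literature.AnabelianGeometry.EtaleTheta.ContH1Reduction
import HarnessLib

/-!
# [EtTh] Prop. 1.3 / Rmk. 1.3.1: an `EtaleThetaData` with REAL `½Δ_Θ`-coefficient groups
# (the "half-carrier" constructor; gives the clauses `eta_res_Ydd`, `resZN_etaN` and `Rmk131` content)

S. Mochizuki, *The étale theta function and its Frobenioid-theoretic manifestations*, Publ. RIMS **45**
(2009), §1, Prop. 1.3 pp. 19–21, Rmk. 1.3.1 p. 21 (printed 245–247) [cite: MochizukiEtTh2009, Prop 1.3 p.20].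
Layer L2 of the abc-iut cell, seat abc-iut-L2-t1 (gen 11; abc-iut-L2-lead R1091 «GO L2-t1 HALF-CARRIER»).
GENERIC over the frozen interface `ThetaSetting p` / `KummerData` / `EtaleThetaData` (`EtaleThetaClass.lean`)
— a class (b) CONSTRUCTION of the frozen record with its unfolding lemmas; no interface clause touched, no
`Prop` fact, no instance.

WHY. The record `EtaleThetaData` carries the `½`-coefficient groups of Prop. 1.3 (p. 20) as ABSTRACT groups,
and the only constructor of record (`KummerData.etaleThetaDataOfClass`, abc-iut-L2-t6) fills them DEGENERATELY
(all `:= H¹(Π^tp_Ÿ, Δ_Θ)`, maps `:= id`): three clauses of `Prop13` hold by `rfl` and `Rmk131` loses its printed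
meaning (abc-iut-L2-lead R1091: class FACT-policy). THIS FILE supplies the honest carrier. The dictionary is the
canonical isomorphism "multiplication by `2`" `½Δ_Θ = Δ_Θ ⊗ ½ℤ →̃ Δ_Θ` (`x ⊗ ½ ↦ x`), under which

* `H¹(−, ½Δ_Θ)` becomes `H¹(−, Δ_Θ)` — the tree's REAL `ContH1` — and the map induced by the inclusion
  `Δ_Θ ↪ ½Δ_Θ` (`x ↦ 2·(x ⊗ ½)`) becomes the SQUARING map `x ↦ x²` (the text writes `H¹` additively: "`log(Ü)
  = ½·log(U)`", p. 23; the frozen interface already types that sentence multiplicatively as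
  `KummerData.res_logU : log(U)|_Ÿ = log(Ü)²`);
* `Δ_Θ ⊗ (½ℤ/Nℤ) ≅ Δ_Θ ⊗ ℤ/2Nℤ = Δ_Θ/Δ_Θ^{2N}` (multiplicatively), so `H¹(−, Δ_Θ ⊗ ½ℤ/Nℤ)` becomes the REAL
  group `H¹(−, Δ_Θ/(2N)·Δ_Θ)` of abc-iut-w5-d234's `ContH1Reduction` (coefficients reduced modulo the normal
  subgroup `(2N)·Δ_Θ = ThetaSetting.lDeltaTheta (2N)` of abc-iut-L2-t8), and the inclusion
  `ℤ/Nℤ ↪ ½ℤ/Nℤ` becomes `ℤ/N → ℤ/2N, a ↦ 2a`;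
* "the evident generalization of the Kummer map" `O^×_{K/K̈} → H¹(G_K, (½ℤ/Nℤ)(1))` (p. 20), for
  `a ∈ O^×_K̈` with `a² ∈ K`, becomes the ORDINARY Kummer class of `a² ∈ K^×` — "compatible with the Kummer
  map `O^×_K → H¹(G_K, (ℤ/Nℤ)(1))` relative to `ℤ/Nℤ ↪ ½ℤ/Nℤ`" is then the identity
  `κ_Y(a²)|_Ÿ = κ̈(a)²` (`KummerData.res_kumSqY`, PROVED from the frozen `res_kumY` / `hatIncl_toKHat`).

So `KummerData.etaleThetaDataHalf E₀ η̈ e : D.EtaleThetaData` takes a Kummer datum `E₀`, the class "without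
denominators" `η̈ ∈ H¹(Π^tp_Ÿ, Δ_Θ)` (p. 21) and a class `e ∈ H¹(Π^tp_Y, Δ_Θ)` playing "`2·η^Θ`" (the limit
class `η^Θ ∈ H¹(Π^tp_Y, ½Δ_Θ)` of p. 20 read through the dictionary), and sets `η^Θ_N := e mod (2N)·Δ_Θ`
("by allowing `N` to vary", p. 20 — so `toLevel_eta` / `toLevel_kum` are definitional, as in print), every
other `½`-group and map being the REAL one. CONSEQUENCES (all `Iff.rfl`-level unfoldings, no mathematics
hidden): `prop13_half_iff` — `Prop13` ⟺ «`e|_Ÿ = x²` for an étale theta class `x ∈ O^×_K̈·η̈`» ∧ «`e mod 2N`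
dies on `Π^tp_{Z̈_N}` for every `N`» (print's "arises from a class ∈ H¹(Π^tp_Y/Π^tp_{Z̈_N}, …)"), and
`rmk131_half_iff` — `Rmk131` ⟺ «`e` is NOT of the form `κ_Y(a²)·x²`, `a ∈ O^×_{K/K̈}`, `x ∈ H¹(Π^tp_Y, Δ_Θ)`»,
i.e. "`η^Θ` does not come from `H¹(Π^tp_Y, Δ_Θ)` up to the `O^×_{K/K̈}`-action" — the denominators `½` are
not superfluous (p. 21); plus a generic vanishing criterion for the `Z̈_N`-clause
(`ContH1.reduce_mk_eq_one_of_forall_mem`). Companion (proof-only): `Discharge/Sec1Rmk131HalfCarrierModelChi.lean`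
(why the `½` encodes NON-DESCENT of `η̈^Θ` to `Y`, and both predicates decided at `ThetaSetting.modelχ`).

HONEST LIMITS: the dictionary `Δ_Θ ⊗ ½ℤ →̃ Δ_Θ` is an ISOMORPHISM of coefficient modules for ANY abelian `Δ_Θ`
(`½ℤ` is free of rank one), so nothing printed is lost or added. Nothing of [EtTh] is asserted; typed ≠ proved;
no side is taken on [IUTchIII] Cor. 3.12.
-/

noncomputable section

namespace Literature.AnabelianGeometry.EtaleTheta

open scoped IsMulCommutative

/-! ### Generic: a reduced class whose cocycle takes values in `B` is trivial -/

namespace ContH1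

variable {G G' : Type*} [Group G] [TopologicalSpace G]
  [Group G'] [TopologicalSpace G'] [IsTopologicalGroup G']
  (φ : G →* G') (A B : Subgroup G') [A.Normal] [IsMulCommutative A] [B.Normal]
  (H : Subgroup G)

/-- **Vanishing criterion modulo `B`**: if a continuous cocycle `f : H → A` takes all its values in `B`,
its class reduces to `1` in `H¹(H, A/B)` (the reduced cocycle is identically `1`). Used for print's clause
"`η^Θ_N` arises from a class `∈ H¹(Π^tp_Y/Π^tp_{Z̈_N}, Δ_Θ ⊗ ½ℤ/Nℤ)`" (Prop. 1.3, p. 20).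
[cite: NeukirchSchmidtWingberg2008, I §2 and II §7] -/
theorem reduce_mk_eq_one_of_forall_mem (f : H → A) (hf : f ∈ contCocycles φ A H)
    (hB : ∀ h : H, ((f h : A) : G') ∈ B) :
    reduce φ A B H (ContH1.mk f hf) = 1 := by
  have hred : reduceCocycle φ A B H ⟨f, hf⟩ = 1 := by
    apply Subtype.ext
    funext h
    apply Subtype.ext
    rw [reduceCocycle_apply_coe]
    change (QuotientGroup.mk' B ((f h : A) : G') : G' ⧸ B) = ((1 : ↥(A.map (QuotientGroup.mk' B))) : G' ⧸ B)
    rw [OneMemClass.coe_one, QuotientGroup.mk'_apply, QuotientGroup.eq_one_iff]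
    exact hB h
  change reduce φ A B H (QuotientGroup.mk (⟨f, hf⟩ : contCocycles φ A H)) = 1
  rw [reduce_mk, hred]
  rfl

end ContH1

namespace ThetaSetting

variable {p : ℕ} [Fact p.Prime] (D : ThetaSetting p)

/-! ### The level-`N` coefficient groups `Δ_Θ ⊗ ½ℤ/Nℤ ≅ Δ_Θ/(2N)·Δ_Θ` and their `H¹` (REAL) -/

/-- `Π^tp_X → (Π^tp_X)^Θ/n·Δ_Θ`: the theta quotient reduced modulo the (normal) `n`-th powers `n·Δ_Θ = lDeltaTheta n`.
[cite: MochizukiEtTh2009, Prop 1.3 p.20] -/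
abbrev toThetaMod (n : ℕ) : D.PiTemp →* D.GtpTheta ⧸ D.lDeltaTheta n :=
  (QuotientGroup.mk' (D.lDeltaTheta n)).comp D.toTheta

/-- `Δ_Θ/n·Δ_Θ = Δ_Θ ⊗ ℤ/nℤ ⊆ (Π^tp_X)^Θ/n·Δ_Θ` — for `n = 2N` this is print's `Δ_Θ ⊗ (½ℤ/Nℤ)` ("`≅ (½ℤ/Nℤ)(1)`",
p. 20) through `½ℤ/Nℤ →̃ ℤ/2Nℤ`, `t ↦ 2t`. [cite: MochizukiEtTh2009, Prop 1.3 p.20] -/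
abbrev DeltaThetaMod (n : ℕ) : Subgroup (D.GtpTheta ⧸ D.lDeltaTheta n) :=
  D.DeltaTheta.map (QuotientGroup.mk' (D.lDeltaTheta n))

/-- **`H¹(H, Δ_Θ ⊗ ℤ/nℤ)`** for `H ≤ Π^tp_X` (REAL: continuous cohomology with the reduced coefficients) — for
`n = 2N` the group `H¹(H, Δ_Θ ⊗ ½ℤ/Nℤ)` of Prop. 1.3 (p. 20). [cite: MochizukiEtTh2009, Prop 1.3 p.20] -/
abbrev H1Mod (n : ℕ) (H : Subgroup D.PiTemp) : Type :=
  ContH1 (D.toThetaMod n) (D.DeltaThetaMod n) H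

/-- Reduction of coefficients `H¹(H, Δ_Θ) → H¹(H, Δ_Θ ⊗ ℤ/nℤ)` — for `n = 2N` the projection
`H¹(H, ½Δ_Θ) → H¹(H, Δ_Θ ⊗ ½ℤ/Nℤ)` of p. 20 read through the dictionary. [cite: MochizukiEtTh2009, Prop 1.3 p.20] -/
abbrev reduceMod (n : ℕ) (H : Subgroup D.PiTemp) : D.H1 H →* D.H1Mod n H :=
  ContH1.reduce D.toTheta D.DeltaTheta (D.lDeltaTheta n) H

/-- `Π^tp_{Z̈_N} ≤ Π^tp_Y` (`Z̈_N → Ÿ_N → Y`, p. 17). [cite: MochizukiEtTh2009, §1 p.17] -/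
theorem GtpZddN_le_GtpY (N : ℕ+) : D.GtpZddN N ≤ D.GtpY :=
  (inf_le_right : D.GtpZddN N ≤ D.GtpZN N).trans ((D.GtpZN_le N).trans (D.GtpYN_le N))

/-! ### "The evident generalization of the Kummer map": `a ↦ κ(a²)` on `O^×_{K/K̈}` -/

/-- The squaring map `O^×_{K/K̈} → K^×`, `a ↦ a²` (`O^×_{K/K̈} := {a ∈ O^×_K̈ | a² ∈ K}`, Prop. 1.3 p. 20).
[cite: MochizukiEtTh2009, Prop 1.3 p.20] -/
def sqToK : D.unitsOKmodKdd →* (↥D.K)ˣ where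
  toFun a := Units.mk0 ⟨((a.1 : D.Kdd) : PadicAlgCl p) ^ 2, a.2.2⟩ (by
    intro h
    have h0 : ((a.1 : D.Kdd) : PadicAlgCl p) ^ 2 = 0 := congrArg Subtype.val h
    have hne : ((a.1 : D.Kdd) : PadicAlgCl p) ≠ 0 := by
      intro hz
      apply a.1.ne_zero
      exact_mod_cast hz
    exact pow_ne_zero 2 hne h0)
  map_one' := by
    ext
    simp
  map_mul' a b := by
    ext
    simp only [Subgroup.coe_mul, Units.val_mul, Units.val_mk0, IntermediateField.coe_mul]
    ring

/-- The value of `sqToK a` in `ℚ̄_p` is `a²`. [cite: MochizukiEtTh2009, Prop 1.3 p.20] -/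
@[simp] theorem coe_sqToK (a : D.unitsOKmodKdd) :
    (((D.sqToK a : (↥D.K)ˣ) : D.K) : PadicAlgCl p) = ((a.1 : D.Kdd) : PadicAlgCl p) ^ 2 := rfl

variable {D}

namespace KummerData

variable (E₀ : D.KummerData)

/-- **"The evident generalization of the Kummer map"** `O^×_{K/K̈} → H¹(G_K, (½ℤ/Nℤ)(1)) → H¹(Π^tp_Y, …)`
(Prop. 1.3, p. 20) in the limit over `N`, read through the dictionary `½Δ_Θ →̃ Δ_Θ`: `a ↦ infl κ_Y(a²)`, the
ordinary `K`-Kummer class of `a² ∈ K^×` in `H¹(Π^tp_Y, Δ_Θ)`. [cite: MochizukiEtTh2009, Prop 1.3 p.20] -/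
def kumSqY : D.unitsOKmodKdd →* D.H1 D.GtpY :=
  ((D.inflTheta D.GtpY).comp E₀.kumY).comp (E₀.toKHat.comp D.sqToK)

/-- `kumSqY` unfolded. [cite: MochizukiEtTh2009, Prop 1.3 p.20] -/
theorem kumSqY_apply (a : D.unitsOKmodKdd) :
    E₀.kumSqY a = D.inflTheta D.GtpY (E₀.kumY (E₀.toKHat (D.sqToK a))) := rfl

/-- Naturality used below: restricting an inflated `Y`-class to `Ÿ` is inflating the restricted class
(both are "evaluate the cocycle on `(Π^tp_Ÿ)^Θ`"). [cite: NeukirchSchmidtWingberg2008, I §5] -/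
theorem res_inflTheta_GtpY (x : D.H1Theta (D.GtpY.map D.toTheta)) :
    ContH1.res D.toTheta D.DeltaTheta D.GtpYdd_le_GtpY (D.inflTheta D.GtpY x) =
      D.inflTheta D.GtpYdd (ContH1.res (MonoidHom.id D.GtpTheta) D.DeltaTheta D.GtpYddTheta_le x) := by
  induction x using QuotientGroup.induction_on with
  | H f => rfl

/-- **Compatibility "relative to `ℤ/Nℤ ↪ ½ℤ/Nℤ`"** (p. 20), kernel form: restricted to `Ÿ`, the generalized
Kummer class of `a ∈ O^×_{K/K̈}` is the SQUARE of the `K̈`-Kummer class of `a`: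
`κ_Y(a²)|_Ÿ = (infl κ̈(a))²` — PROVED from the frozen interface laws `res_kumY`, `hatIncl_toKHat`.
[cite: MochizukiEtTh2009, Prop 1.3 p.20] -/
theorem res_kumSqY (a : D.unitsOKmodKdd) :
    ContH1.res D.toTheta D.DeltaTheta D.GtpYdd_le_GtpY (E₀.kumSqY a) = E₀.kumUnitsModHom a ^ 2 := by
  rw [kumSqY_apply, res_inflTheta_GtpY, E₀.res_kumY, kumUnitsModHom_apply, ← map_pow, ← map_pow, ← map_pow]
  congr 2
  apply E₀.hatIncl_toKHat
  rw [coe_sqToK]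
  push_cast
  rfl

/-! ### The constructor -/

/-- **`EtaleThetaData` with REAL `½`-coefficient groups** from a Kummer datum `E₀`, the class "without
denominators" `η̈ ∈ H¹(Π^tp_Ÿ, Δ_Θ)` (p. 21) and a class `e ∈ H¹(Π^tp_Y, Δ_Θ)` standing for "`2·η^Θ`",
`η^Θ ∈ H¹(Π^tp_Y, ½Δ_Θ)` (p. 20), through the dictionary `½Δ_Θ →̃ Δ_Θ` (module docstring):
`H¹(Π^tp_Y, ½Δ_Θ) := H¹(Π^tp_Y, Δ_Θ)`, `H¹(Π^tp_Ÿ, ½Δ_Θ) := H¹(Π^tp_Ÿ, Δ_Θ)` with `ofIntegral(Y) := x ↦ x²` and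
`resHalf :=` the real restriction; `H¹(Π^tp_Y, Δ_Θ ⊗ ½ℤ/Nℤ) := H¹(Π^tp_Y, Δ_Θ/(2N)·Δ_Θ)`,
`H¹(Π^tp_{Z̈_N}, …)` likewise, `toLevel N :=` reduction mod `(2N)·Δ_Θ`, `resZN N :=` the real restriction along
`Π^tp_{Z̈_N} ≤ Π^tp_Y`; `η^Θ_N := e mod (2N)·Δ_Θ` ("by allowing `N` to vary", p. 20); the `O^×_{K/K̈}`-actions
`:= κ_Y(a²)` and its reductions ("the evident generalization of the Kummer map", p. 20).
[cite: MochizukiEtTh2009, Prop 1.3 p.20] -/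
def etaleThetaDataHalf (η : D.H1 D.GtpYdd) (e : D.H1 D.GtpY) : D.EtaleThetaData where
  toKummerData := E₀
  etaDd := η
  H1YhalfN N := D.H1Mod (2 * N) D.GtpY
  etaN N := D.reduceMod (2 * N) D.GtpY e
  kumN N := (D.reduceMod (2 * N) D.GtpY).comp E₀.kumSqY
  H1Yhalf := D.H1 D.GtpY
  eta := e
  toLevel N := D.reduceMod (2 * N) D.GtpY
  kumHalf := E₀.kumSqY
  ofIntegralY := powMonoidHom 2
  H1YddHalf := D.H1 D.GtpYdd
  resHalf := ContH1.res D.toTheta D.DeltaTheta D.GtpYdd_le_GtpY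
  ofIntegral := powMonoidHom 2
  resHalf_ofIntegralY x := by simp only [powMonoidHom_apply, map_pow]
  H1ZddN N := D.H1Mod (2 * N) (D.GtpZddN N)
  resZN N := ContH1.res (D.toThetaMod (2 * N)) (D.DeltaThetaMod (2 * N)) (D.GtpZddN_le_GtpY N)

variable (η : D.H1 D.GtpYdd) (e : D.H1 D.GtpY)

/-- The underlying Kummer datum is the given one. [cite: MochizukiEtTh2009, Prop 1.3 p.20] -/
@[simp] theorem toKummerData_etaleThetaDataHalf : (E₀.etaleThetaDataHalf η e).toKummerData = E₀ := rfl

/-- `η̈^Θ` of the constructed data is the given class. [cite: MochizukiEtTh2009, Prop 1.3 p.21] -/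
@[simp] theorem etaDd_etaleThetaDataHalf : (E₀.etaleThetaDataHalf η e).etaDd = η := rfl

/-- The limit class "`2·η^Θ`" is the given `Y`-class `e`. [cite: MochizukiEtTh2009, Prop 1.3 p.20] -/
@[simp] theorem eta_etaleThetaDataHalf : (E₀.etaleThetaDataHalf η e).eta = e := rfl

/-- `η^Θ_N = e mod (2N)·Δ_Θ`. [cite: MochizukiEtTh2009, Prop 1.3 p.20] -/
@[simp] theorem etaN_etaleThetaDataHalf (N : ℕ+) :
    (E₀.etaleThetaDataHalf η e).etaN N = D.reduceMod (2 * N) D.GtpY e := rfl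

/-- The `O^×_{K/K̈}`-action in the limit is `a ↦ κ_Y(a²)`. [cite: MochizukiEtTh2009, Prop 1.3 p.20] -/
@[simp] theorem kumHalf_etaleThetaDataHalf : (E₀.etaleThetaDataHalf η e).kumHalf = E₀.kumSqY := rfl

/-- `H¹(Π^tp_Y, Δ_Θ) → H¹(Π^tp_Y, ½Δ_Θ)` is squaring. [cite: MochizukiEtTh2009, Rmk 1.3.1 p.21] -/
@[simp] theorem ofIntegralY_etaleThetaDataHalf_apply (x : D.H1 D.GtpY) :
    (E₀.etaleThetaDataHalf η e).ofIntegralY x = x ^ 2 := rfl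

/-- `H¹(Π^tp_Ÿ, Δ_Θ) → H¹(Π^tp_Ÿ, ½Δ_Θ)` is squaring. [cite: MochizukiEtTh2009, Prop 1.3 p.21] -/
@[simp] theorem ofIntegral_etaleThetaDataHalf_apply (x : D.H1 D.GtpYdd) :
    (E₀.etaleThetaDataHalf η e).ofIntegral x = x ^ 2 := rfl

/-- `H¹(Π^tp_Y, ½Δ_Θ) → H¹(Π^tp_Ÿ, ½Δ_Θ)` is the real restriction. [cite: MochizukiEtTh2009, Prop 1.3 p.20] -/
@[simp] theorem resHalf_etaleThetaDataHalf_apply (x : D.H1 D.GtpY) :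
    (E₀.etaleThetaDataHalf η e).resHalf x = ContH1.res D.toTheta D.DeltaTheta D.GtpYdd_le_GtpY x := rfl

/-- The étale theta classes `O^×_K̈ · η̈` of the constructed data are those of `(E₀, η̈)` (they do not involve
the `½`-groups). [cite: MochizukiEtTh2009, Prop 1.3 p.21] -/
theorem thetaClasses_etaleThetaDataHalf :
    (E₀.etaleThetaDataHalf η e).thetaClasses = {x | ∃ k ∈ E₀.kumUnitsYdd, x = k * η} := rfl

/-- `η̈` itself is an étale theta class of the constructed data (unit `1`). [cite: MochizukiEtTh2009, Prop 1.3 p.21] -/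
theorem mem_thetaClasses_etaleThetaDataHalf : η ∈ (E₀.etaleThetaDataHalf η e).thetaClasses :=
  ⟨1, one_mem _, (one_mul η).symm⟩

/-! ### Prop. 1.3 and Rmk. 1.3.1 unfolded at the half-carrier data -/

/-- **Prop. 1.3 at the half-carrier data, unfolded**: `toLevel_eta` / `toLevel_kum` are definitional
(print DEFINES `η^Θ` from the `η^Θ_N` "by allowing `N` to vary"); the content is (1) "`η^Θ|_Ÿ` arises from a
class `O^×_K̈·η̈^Θ` without denominators" = `e|_Ÿ = x²` for an étale theta class `x`, and (2) "`η^Θ_N` arises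
from a class `∈ H¹(Π^tp_Y/Π^tp_{Z̈_N}, …)`" = `e mod (2N)·Δ_Θ` restricts to `1` on `Π^tp_{Z̈_N}`.
[cite: MochizukiEtTh2009, Prop 1.3 p.20] -/
theorem prop13_half_iff : Prop13 (E₀.etaleThetaDataHalf η e) ↔
    (∃ x ∈ (E₀.etaleThetaDataHalf η e).thetaClasses,
        ContH1.res D.toTheta D.DeltaTheta D.GtpYdd_le_GtpY e = x ^ 2) ∧
      ∀ N : ℕ+, ContH1.res (D.toThetaMod (2 * N)) (D.DeltaThetaMod (2 * N)) (D.GtpZddN_le_GtpY N)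
        (D.reduceMod (2 * N) D.GtpY e) = 1 :=
  ⟨fun h => ⟨h.eta_res_Ydd, h.resZN_etaN⟩, fun ⟨h1, h2⟩ =>
    { toLevel_eta := fun _ => rfl, toLevel_kum := fun _ _ => rfl, eta_res_Ydd := h1, resZN_etaN := h2 }⟩

/-- The `Z̈_N`-clause through `res ∘ reduce = reduce ∘ res`: it suffices that the RESTRICTED class reduces
to `1`. [cite: MochizukiEtTh2009, Prop 1.3 p.20] -/
theorem resZN_etaN_half_iff (N : ℕ+) :
    (E₀.etaleThetaDataHalf η e).resZN N ((E₀.etaleThetaDataHalf η e).etaN N) = 1 ↔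
      D.reduceMod (2 * N) (D.GtpZddN N) (ContH1.res D.toTheta D.DeltaTheta (D.GtpZddN_le_GtpY N) e) = 1 := by
  change ContH1.res (D.toThetaMod (2 * N)) (D.DeltaThetaMod (2 * N)) (D.GtpZddN_le_GtpY N)
      (D.reduceMod (2 * N) D.GtpY e) = 1 ↔ _
  rw [ContH1.res_reduce]

/-- **Rmk. 1.3.1 at the half-carrier data, unfolded** ("the denominators `½` in Proposition 1.3 are by no
means superfluous", p. 21): `e = 2·η^Θ` is NOT of the form `κ_Y(a²) · x²` with `a ∈ O^×_{K/K̈}`,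
`x ∈ H¹(Π^tp_Y, Δ_Θ)` — i.e. `η^Θ ∈ H¹(Π^tp_Y, ½Δ_Θ)` does not come from `H¹(Π^tp_Y, Δ_Θ)` up to the
`O^×_{K/K̈}`-action. [cite: MochizukiEtTh2009, Rmk 1.3.1 p.21] -/
theorem rmk131_half_iff : Rmk131 (E₀.etaleThetaDataHalf η e) ↔
    ∀ (a : D.unitsOKmodKdd) (x : D.H1 D.GtpY), E₀.kumSqY a * e ≠ x ^ 2 :=
  Iff.rfl

/-- Rmk. 1.3.1 FAILS at the half-carrier data as soon as `e = κ_Y(a²) · x²` for some `a`, `x`.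
[cite: MochizukiEtTh2009, Rmk 1.3.1 p.21] -/
theorem not_rmk131_half_of_eq (a : D.unitsOKmodKdd) (x : D.H1 D.GtpY) (h : e = E₀.kumSqY a * x ^ 2) :
    ¬ Rmk131 (E₀.etaleThetaDataHalf η e) := fun hR =>
  hR a⁻¹ x (by
    change E₀.kumSqY a⁻¹ * e = x ^ 2
    rw [h, ← mul_assoc, ← map_mul, inv_mul_cancel, map_one, one_mul])

/-- In particular, if `e` is itself a square over `Y`, Rmk. 1.3.1 fails. [cite: MochizukiEtTh2009, Rmk 1.3.1 p.21] -/
theorem not_rmk131_half_of_eq_sq (x : D.H1 D.GtpY) (h : e = x ^ 2) : ¬ Rmk131 (E₀.etaleThetaDataHalf η e) :=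
  E₀.not_rmk131_half_of_eq η e 1 x (by rw [map_one, one_mul, h])

end KummerData

end ThetaSetting

end Literature.AnabelianGeometry.EtaleTheta

end
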